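import Summits.BirchSwinnertonDyer.Rank1Residual.X12.SpecialJIrreducibleAnyModel
import Literature.NumberTheory.EllipticCurves.ComplexMultiplicationTwistIsogenyCertProofs
import Literature.NumberTheory.EllipticCurves.ComplexMultiplicationMaximalOrderProofs
import Literature.NumberTheory.EllipticCurves.ComplexMultiplicationBSDTripleProofs
import Literature.NumberTheory.EllipticCurves.BSDSelmerCMPConverseMaximalOrderProofs
import Literature.NumberTheory.EllipticCurves.IsogenyFrobeniusTraceProofs
import Literature.NumberTheory.EllipticCurves.QuadraticTwistProofs
import Literature.NumberTheory.EllipticCurves.Rank1Residual.Predicates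
import Mathlib.NumberTheory.LegendreSymbol.JacobiSymbol
import HarnessLib

/-!
# Deuring for the thirteen CM classes over `ℚ` in the cell's vocabulary: `a_ℓ(E) = 0` at every good
# prime `ℓ` inert in the CM field, and the inert-class supply `(d_K/ℓ) = −1` for `ℓ ≡ −1 (mod 4|d_K|)`

HONEST FRAMING (cell `b2b-bsdres`, run/shared/lean/b2b/bsd-rank1-residual/, verbatim in every
file): the goal of the cell is to DELETE the COMBINATION-SHAPED residual classes of the
Birch–Swinnerton-Dyer formula for ALL analytic-rank `≤ 1` elliptic curves over `ℚ` — "full BSD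
formula for every rank `≤ 1` curve in class `C`" assembled STRICTLY from published theorems — so
that the rank-`≤ 1` remainder becomes exactly the CONSTRUCTION-SHAPED classes, which are TYPED
(missing-input `Prop`s), NOT attempted. This is not "finishing BSD". Harvest seat 1 (census owner
of class X12), generation 15. Theorems only (no definition, no named fact, no axiom); nothing is
booked; no label and no census number moves.

## Why this file

Gen 14 (`SpecialJIrreducible.lean`, p204456) made the irreducibility input (a) of the X12
Matar–Nekovář route (`T-MN19`, REFEREE-2.md §25E R2-25.3) a THEOREM for `j ∈ {0, 1728}` — Deuring's
`a_ℓ = 0` at the inert primes (Ireland–Rosen 18 §3–§4, point counts) + Dirichlet + Mazur's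
Frobenius criterion. The sibling file `CMIrreducible.lean` extends this to ALL THIRTEEN CM
`j`-invariants over `ℚ` (`E[p]` irreducible at every odd prime `p` unramified in the CM field,
i.e. `¬ CMRamified E p` in the cell's `Predicates`). This file supplies its two arithmetic inputs,
both compositions BY NAME of tree theorems (every named fact used here is DISCHARGED in the tree):

* §1 `jacobiSym_neg_natCast_eq_neg_one_of_mod_eq` — **the inert-class supply**: for `m ≥ 1` and
  `ℓ ≡ −1 (mod 4m)`, the Jacobi symbol `(−m/ℓ) = −1` (quadratic reciprocity in Mathlib's form
  `jacobiSym.mod_right`: `(a/b)` depends on `b mod 4|a|`; then `(−1/4m−1) = χ₄(4m−1) = −1` and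
  `(m/4m−1) = 1` because `4m ≡ 1`). So Dirichlet primes `ℓ ≡ −1 (mod 4|d_K|)` are inert in
  `K = ℚ(√d_K)`.
* §2 `frobeniusTrace_twist_eq_legendreSym_mul` — the tree's twisting formula
  `a_ℓ(E^{(d)}) = (d/ℓ) a_ℓ(E)` (`frobeniusTrace_quadraticTwist_holds`, Knapp Prop. 12.10) with a
  square factor allowed in `d` (`d = d₀e²`, `E^{(d)} ≅ E^{(d₀)}`), since `d_K ∈ {−4, −8}` is not
  squarefree; and the table `exists_cmFieldDiscr_eq_mul_sq` (`d_K = d₀e²`, `e ∣ 2`).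
* §3 `frobeniusTrace_eq_zero_of_legendreSym_cmFieldDiscr_eq_neg_one` — **Deuring's theorem for CM
  by the maximal order, in the cell's vocabulary**: for a globally minimal `E/ℚ` with
  `j(E) ∈ maximalCMJInvariants` (CM by `𝒪_K`, `d_K = cmFieldDiscr j`) and a good prime `ℓ ∤ 2d_K`
  with `(d_K/ℓ) = −1`: **`a_ℓ(E) = 0`**. Proof: `E ~ E^{(d_K)}` over `ℚ` (Burungale–Flach, proof
  of Cor. 2 / Milne 1972 Thm. 3 — the tree's PROVED `isIsogenous_quadraticTwist_cmFieldDiscr_holds`,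
  six kernel-certified isogenies + `j = 0, 1728, 8000`), isogenous curves have the same `a_ℓ`
  (Faltings 1983 §5 Kor. 2 / *AEC* Ex. 5.4, tree `frobeniusTrace_eq_of_isIsogenous`), and
  `a_ℓ(E^{(d_K)}) = (d_K/ℓ) a_ℓ(E) = −a_ℓ(E)`; hence `2a_ℓ = 0`. (Classically: Deuring 1941; Lang,
  *Elliptic Functions*, Ch. 13 §4 Thm. 12 — `ℓ` inert in `K` ⟺ supersingular reduction; the tree
  also has that route, `natCast_dvd_frobeniusTrace_iff_not_isSquare_of_reduction`, in the
  `ψ² = D` form, used in `CMIrreducible.lean` §1.)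
* §4 `exists_isIsogenous_maximal_cmFieldDiscr_eq` — the isogeny to CM by the MAXIMAL order
  (Silverman *AT* II Ex. 2.12(b); tree `…_of_j_mem_nonmaximalCMJInvariants_holds`: the explicit
  `2`-isogenies `54000 ~ 0`, `287496 ~ 1728`, `16581375 ~ −3375` and Vélu's `3`-isogeny
  `−12288000 ~ 0`, transported along `j`) WITH THE FIELD RECORDED: the target's `cmFieldDiscr`
  equals the source's `cmFieldDiscrOfJ` (cell `Predicates`), so that "`p` unramified in the CM
  field" transfers along the isogeny.

## What is NOT claimed

Nothing is booked and no label moves; X12 stays CONSTRUCTION-SHAPED. These are inputs of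
`CMIrreducible.lean` (condition (a) of `T-MN19` as a theorem for every CM curve over `ℚ` at every
odd prime unramified in the CM field).

References: M. Deuring, Abh. Math. Sem. Univ. Hamburg 14 (1941) [Deuring1941]; S. Lang, *Elliptic
Functions*, GTM 112, Ch. 13 §4 Thm. 12 [Lang1987]; A. Burungale, M. Flach, Camb. J. Math. 12 (2024),
proof of Cor. 2 [BurungaleFlach2024]; J. S. Milne, Invent. Math. 17 (1972) Thm. 3
[Milne1972ArithmeticAV]; G. Faltings, Invent. Math. 73 (1983) §5 Kor. 2 [Faltings1983Endlichkeit];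
A. W. Knapp, *Elliptic Curves* (1992) Prop. 12.10 [Knapp1993]; J. H. Silverman, *Advanced Topics*,
GTM 151 (1994), II Ex. 2.12(b), App. A §3 [SilvermanAdvancedTopics1994] / [SilvermanATAEC1994];
harvest-1 RECLASSIFY.md §GEN-15.
-/

set_option autoImplicit false

noncomputable section

open scoped Classical NumberTheorySymbols

open WeierstrassCurve Literature.NumberTheory.EllipticCurves
  Literature.NumberTheory.EllipticCurves.Rank1Residual

namespace Summit.BirchSwinnertonDyer.Rank1Residual.X12

/-! ## §1 The inert-class supply: `(−m/ℓ) = −1` for `ℓ ≡ −1 (mod 4m)` -/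

/-- **`(−m/ℓ) = −1` whenever `ℓ ≡ −1 (mod 4m)`** (`m ≥ 1`; Jacobi symbols). By quadratic
reciprocity in the form "`(a/b)` depends only on `b mod 4|a|`" (Mathlib `jacobiSym.mod_right`),
`(−m/ℓ) = (−m/4m−1) = (−1/4m−1)·(m/4m−1)`; the first factor is `χ₄(4m−1) = −1`, the second is `1`
because `4m ≡ 1 (mod 4m−1)` gives `(4/4m−1)(m/4m−1) = (1/4m−1) = 1` and `(4/·) = (2/·)² = 1`.
Used with `m = |d_K|`: every prime `ℓ ≡ −1 (mod 4|d_K|)` is inert in `ℚ(√d_K)`. [folklore] -/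
theorem jacobiSym_neg_natCast_eq_neg_one_of_mod_eq {m : ℕ} (hm : 0 < m) {ℓ : ℕ}
    (hℓ : ℓ % (4 * m) = 4 * m - 1) : J(-(m : ℤ) | ℓ) = -1 := by
  -- `ℓ ≡ 3 (mod 4)`, so `ℓ` is odd
  have hℓ4 : ℓ % 4 = 3 := by
    have h := Nat.mod_mod_of_dvd ℓ (dvd_mul_right 4 m)
    rw [hℓ] at h
    omega
  have hℓodd : Odd ℓ := Nat.odd_iff.mpr (by omega)
  -- reduce the lower entry modulo `4 |−m| = 4 m`
  have hnat : (-(m : ℤ)).natAbs = m := by simp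
  rw [jacobiSym.mod_right (-(m : ℤ)) hℓodd, hnat, hℓ]
  -- the modulus `M = 4m − 1`
  set M : ℕ := 4 * m - 1 with hM
  have hM4 : M % 4 = 3 := by omega
  have hModd : Odd M := Nat.odd_iff.mpr (by omega)
  have h1 : J(-1 | M) = -1 := by
    rw [jacobiSym.at_neg_one hModd, ZMod.χ₄_nat_three_mod_four hM4]
  have h4 : J(4 | M) = 1 := by
    have hg : Int.gcd 2 (M : ℤ) = 1 := by
      rw [Int.gcd_eq_natAbs]
      change Nat.gcd 2 M = 1
      exact (Nat.Prime.coprime_iff_not_dvd Nat.prime_two).mpr (by omega)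
    have h := jacobiSym.sq_one' (a := 2) (b := M) hg
    norm_num at h
    exact h
  have hmod : ((4 * m : ℕ) : ℤ) % (M : ℕ) = 1 % (M : ℕ) := by
    have : ((4 * m : ℕ) : ℤ) = 1 + (M : ℤ) * 1 := by push_cast; omega
    rw [this, Int.add_mul_emod_self_left]
  have h4m : J(((4 * m : ℕ) : ℤ) | M) = 1 := by
    rw [jacobiSym.mod_left' hmod, jacobiSym.one_left]
  have hmM : J((m : ℤ) | M) = 1 := by
    rw [show ((4 * m : ℕ) : ℤ) = 4 * (m : ℤ) by push_cast; ring, jacobiSym.mul_left, h4,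
      one_mul] at h4m
    exact h4m
  rw [show (-(m : ℤ)) = -1 * (m : ℤ) by ring, jacobiSym.mul_left, h1, hmM]
  norm_num

/-- Prime form: for a prime `ℓ ≡ −1 (mod 4m)`, `−m` is a quadratic NON-residue mod `ℓ`. [folklore] -/
theorem not_isSquare_neg_natCast_of_mod_eq {m : ℕ} (hm : 0 < m) {ℓ : ℕ} [Fact ℓ.Prime]
    (hℓ : ℓ % (4 * m) = 4 * m - 1) : ¬ IsSquare ((-(m : ℤ) : ℤ) : ZMod ℓ) :=
  ZMod.nonsquare_iff_jacobiSym_eq_neg_one.mp (jacobiSym_neg_natCast_eq_neg_one_of_mod_eq hm hℓ)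

/-- Legendre form: for a prime `ℓ ≡ −1 (mod 4m)`, `(−m/ℓ) = −1`. [folklore] -/
theorem legendreSym_neg_natCast_eq_neg_one_of_mod_eq {m : ℕ} (hm : 0 < m) {ℓ : ℕ} [Fact ℓ.Prime]
    (hℓ : ℓ % (4 * m) = 4 * m - 1) : legendreSym ℓ (-(m : ℤ)) = -1 := by
  rw [jacobiSym.legendreSym.to_jacobiSym]
  exact jacobiSym_neg_natCast_eq_neg_one_of_mod_eq hm hℓ

/-! ## §2 The twisting formula with a square factor, and the square-free core of `d_K` -/

/-- **`a_ℓ(W') = (d₀/ℓ) · a_ℓ(W)` for `W'` a globally minimal model of the twist `W^{(d₀e²)}`**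
(`d₀` squarefree, `e ≠ 0`, `ℓ ∤ 2d₀`, `ℓ` good for `W`): the tree's twisting formula
`frobeniusTrace_quadraticTwist_holds` (Knapp, *Elliptic Curves*, Prop. 12.10) after the
`ℚ`-isomorphism `W^{(d₀e²)} ≅ W^{(d₀)}` (`exists_variableChange_quadraticTwist_mul_sq`, *AEC*
X.5.4). [cite: Knapp1993, Prop. 12.10 (PDF pp. 302–303)] -/
theorem frobeniusTrace_twist_eq_legendreSym_mul (W W' : WeierstrassCurve ℚ) [W.IsElliptic]
    [W.IsGloballyMinimal] [W'.IsGloballyMinimal] {d₀ : ℤ} (hd₀ : Squarefree d₀) {e : ℚ} (he : e ≠ 0)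
    (hW' : ∃ C : VariableChange ℚ, C • W' = W.quadraticTwist ((d₀ : ℚ) * e ^ 2)) (ℓ : ℕ)
    [Fact ℓ.Prime] (hℓd : ¬ (ℓ : ℤ) ∣ 2 * d₀) (hgood : ¬ (ℓ : ℤ) ∣ W.minimalDiscriminantInt) :
    W'.frobeniusTrace ℓ = legendreSym ℓ d₀ * W.frobeniusTrace ℓ := by
  obtain ⟨C, hC⟩ := hW'
  obtain ⟨C₂, hC₂⟩ := W.exists_variableChange_quadraticTwist_mul_sq (d₀ : ℚ) e he
  exact frobeniusTrace_quadraticTwist_holds W W' d₀ hd₀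
    ⟨C₂⁻¹ * C, by rw [mul_smul, hC, ← hC₂, inv_smul_smul]⟩ ℓ hℓd hgood

/-- **The square-free core of `d_K`** on the nine maximal-order CM `j`-invariants:
`d_K = d₀ · e²` with `d₀ ∈ {−3, −1, −7, −2, −11, −19, −43, −67, −163}` squarefree and `e ∣ 2`
(`e = 2` exactly for `d_K = −4, −8`). Silverman, *Advanced Topics*, App. A §3.
[cite: SilvermanATAEC1994, App. A §3 (first table)] -/
theorem exists_cmFieldDiscr_eq_mul_sq {j : ℚ} (hj : j ∈ maximalCMJInvariants) :
    ∃ d₀ : ℤ, ∃ e : ℕ, Squarefree d₀ ∧ e ∣ 2 ∧ cmFieldDiscr j = d₀ * (e : ℤ) ^ 2 := by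
  have hsf : ∀ q : ℕ, q.Prime → Squarefree (-(q : ℤ)) := fun q hq ↦ by
    rw [← Int.squarefree_natAbs, Int.natAbs_neg, Int.natAbs_natCast]
    exact hq.prime.squarefree
  have h1 : Squarefree (-1 : ℤ) := by
    rw [← Int.squarefree_natAbs, show (-1 : ℤ).natAbs = 1 by decide]
    exact squarefree_one
  simp only [maximalCMJInvariants, Finset.mem_insert, Finset.mem_singleton] at hj
  rcases hj with rfl | rfl | rfl | rfl | rfl | rfl | rfl | rfl | rfl
  · exact ⟨-3, 1, by exact_mod_cast hsf 3 Nat.prime_three, one_dvd _, by norm_num [cmFieldDiscr]⟩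
  · exact ⟨-1, 2, h1, dvd_rfl, by norm_num [cmFieldDiscr]⟩
  · exact ⟨-7, 1, by exact_mod_cast hsf 7 (by norm_num), one_dvd _, by norm_num [cmFieldDiscr]⟩
  · exact ⟨-2, 2, by exact_mod_cast hsf 2 Nat.prime_two, dvd_rfl, by norm_num [cmFieldDiscr]⟩
  · exact ⟨-11, 1, by exact_mod_cast hsf 11 (by norm_num), one_dvd _, by norm_num [cmFieldDiscr]⟩
  · exact ⟨-19, 1, by exact_mod_cast hsf 19 (by norm_num), one_dvd _, by norm_num [cmFieldDiscr]⟩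
  · exact ⟨-43, 1, by exact_mod_cast hsf 43 (by norm_num), one_dvd _, by norm_num [cmFieldDiscr]⟩
  · exact ⟨-67, 1, by exact_mod_cast hsf 67 (by norm_num), one_dvd _, by norm_num [cmFieldDiscr]⟩
  · exact ⟨-163, 1, by exact_mod_cast hsf 163 (by norm_num), one_dvd _,
      by norm_num [cmFieldDiscr]⟩

/-- On the nine maximal-order values the cell's `cmFieldDiscrOfJ` (`Rank1Residual/Predicates`,
all thirteen CM `j`) agrees with the tree's `cmFieldDiscr` (`ComplexMultiplicationBurungaleFlachDescent`).
[cite: SilvermanATAEC1994, App. A §3 (first table)] -/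
theorem cmFieldDiscr_eq_cmFieldDiscrOfJ {j : ℚ} (hj : j ∈ maximalCMJInvariants) :
    cmFieldDiscr j = cmFieldDiscrOfJ j := by
  simp only [maximalCMJInvariants, Finset.mem_insert, Finset.mem_singleton] at hj
  rcases hj with rfl | rfl | rfl | rfl | rfl | rfl | rfl | rfl | rfl <;>
    norm_num [cmFieldDiscr, cmFieldDiscrOfJ]

/-- `d_K = −|d_K|` with `|d_K| ≥ 1` on the maximal-order values (the shape used with §1).
[cite: SilvermanATAEC1994, App. A §3 (first table)] -/
theorem cmFieldDiscr_eq_neg_natAbs {j : ℚ} (hj : j ∈ maximalCMJInvariants) :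
    cmFieldDiscr j = -((cmFieldDiscr j).natAbs : ℤ) ∧ 0 < (cmFieldDiscr j).natAbs := by
  have h := cmFieldDiscr_neg hj
  refine ⟨?_, Int.natAbs_pos.mpr h.ne⟩
  rw [Int.natCast_natAbs, abs_of_neg h, neg_neg]

/-! ## §3 Deuring for CM by the maximal order: `(d_K/ℓ) = −1 ⟹ a_ℓ = 0` -/

/-- **Deuring's theorem (inert primes are supersingular) for the nine maximal-order CM classes over
`ℚ`, via the twist-isogeny.** Let `W/ℚ` be a globally minimal elliptic curve with
`j(W) ∈ maximalCMJInvariants` (CM by `𝒪_K`, `K = ℚ(√d_K)`, `d_K = cmFieldDiscr j(W)`) and `ℓ`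
a prime with `ℓ ∤ 2d_K`, `ℓ ∤ Δ_min(W)` and `(d_K/ℓ) = −1` (`ℓ` inert in `K`). Then
**`a_ℓ(W) = 0`**. Proof: `W ~ W^{(d_K)}` over `ℚ` (Burungale–Flach 2024, proof of Cor. 2; Milne
1972 Thm. 3; tree theorem `isIsogenous_quadraticTwist_cmFieldDiscr_holds`), so for a globally
minimal model `W₂` of `W^{(d_K)}` (Silverman VIII.8.3, `hasGlobalMinimalModel_rat_holds`):
`a_ℓ(W) = a_ℓ(W₂)` (Faltings 1983 §5 Kor. 2, `frobeniusTrace_eq_of_isIsogenous`; `W₂` is good at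
`ℓ`, *AEC* VII.7.2) and `a_ℓ(W₂) = (d₀/ℓ) a_ℓ(W) = (d_K/ℓ) a_ℓ(W) = −a_ℓ(W)` (§2, `d_K = d₀e²`,
`e ∣ 2`, `ℓ` odd). Deuring 1941; Lang, *Elliptic Functions*, Ch. 13 §4 Thm. 12.
[cite: Lang1987, Ch. 13 §4 Thm. 12 (PDF p. 140)] [cite: Deuring1941]
[cite: BurungaleFlach2024, proof of Cor. 2 (arXiv p. 4)] [cite: Faltings1983Endlichkeit, §5 Korollar 2, (i) ⇒ (iv)] -/
theorem frobeniusTrace_eq_zero_of_legendreSym_cmFieldDiscr_eq_neg_one (W : WeierstrassCurve ℚ)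
    [W.IsElliptic] [W.IsGloballyMinimal] (hj : W.j ∈ maximalCMJInvariants) (ℓ : ℕ) [hℓ : Fact ℓ.Prime]
    (hℓd : ¬ (ℓ : ℤ) ∣ 2 * cmFieldDiscr W.j) (hℓΔ : ¬ (ℓ : ℤ) ∣ minimalDiscriminantInt W)
    (hinert : legendreSym ℓ (cmFieldDiscr W.j) = -1) : W.frobeniusTrace ℓ = 0 := by
  have hd : cmFieldDiscr W.j < 0 := cmFieldDiscr_neg hj
  have hd0 : (cmFieldDiscr W.j : ℚ) ≠ 0 := by exact_mod_cast hd.ne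
  -- `W ~ W^{(d_K)}` and a globally minimal model `W₂` of the twist
  have hiso : IsIsogenous W (W.quadraticTwist (cmFieldDiscr W.j : ℚ)) :=
    isIsogenous_quadraticTwist_cmFieldDiscr_holds W hj
  haveI := W.isElliptic_quadraticTwist hd0
  obtain ⟨C, hC⟩ := hasGlobalMinimalModel_rat_holds (W.quadraticTwist (cmFieldDiscr W.j : ℚ))
  haveI := hC
  have hiso₂ : IsIsogenous W (C • W.quadraticTwist (cmFieldDiscr W.j : ℚ)) := hiso.smul_right C
  have hgood : W.HasGoodReductionAtPrime ℓ := hasGoodReductionAtPrime_of_not_dvd W ℓ hℓΔ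
  have hgood₂ : (C • W.quadraticTwist (cmFieldDiscr W.j : ℚ)).HasGoodReductionAtPrime ℓ :=
    (hiso₂.hasGoodReductionAtPrime_iff ℓ).mp hgood
  -- `a_ℓ(W) = a_ℓ(W₂)`
  have h1 : W.frobeniusTrace ℓ = (C • W.quadraticTwist (cmFieldDiscr W.j : ℚ)).frobeniusTrace ℓ :=
    frobeniusTrace_eq_of_isIsogenous hiso₂ ℓ hgood hgood₂
  -- `a_ℓ(W₂) = (d₀/ℓ) a_ℓ(W)` with `d_K = d₀ e²`
  obtain ⟨d₀, e, hsf, he2, hde⟩ := exists_cmFieldDiscr_eq_mul_sq hj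
  have he0 : e ≠ 0 := by
    rintro rfl
    simp at he2
  have hW₂ : ∃ C' : VariableChange ℚ, C' • (C • W.quadraticTwist (cmFieldDiscr W.j : ℚ)) =
      W.quadraticTwist ((d₀ : ℚ) * (e : ℚ) ^ 2) :=
    ⟨C⁻¹, by rw [inv_smul_smul, hde]; push_cast; ring_nf⟩
  have hℓd₀ : ¬ (ℓ : ℤ) ∣ 2 * d₀ := fun h ↦ hℓd (by
    rw [hde, ← mul_assoc]
    exact Dvd.dvd.mul_right h _)
  have h2 := frobeniusTrace_twist_eq_legendreSym_mul W (C • W.quadraticTwist (cmFieldDiscr W.j : ℚ))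
    hsf (e := (e : ℚ)) (by exact_mod_cast he0) hW₂ ℓ hℓd₀ hℓΔ
  -- `(d₀/ℓ) = (d_K/ℓ) = −1` (`ℓ` odd, `e ∣ 2`)
  have hℓ2 : ℓ ≠ 2 := by
    rintro rfl
    exact hℓd (dvd_mul_right 2 _)
  have heℓ : ((e : ℤ) : ZMod ℓ) ≠ 0 := by
    intro h0
    rw [Int.cast_natCast, ZMod.natCast_eq_zero_iff] at h0
    have hle : ℓ ∣ 2 := h0.trans he2
    have := (Nat.prime_dvd_prime_iff_eq hℓ.out Nat.prime_two).mp hle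
    exact hℓ2 this
  have h3 : legendreSym ℓ (cmFieldDiscr W.j) = legendreSym ℓ d₀ := by
    rw [hde, legendreSym.mul, legendreSym.sq_one' (p := ℓ) heℓ, mul_one]
  have hL : legendreSym ℓ d₀ = -1 := by rw [← h3]; exact hinert
  rw [hL, ← h1] at h2
  linarith

/-- The same with the inert condition in residue form: `d_K` a non-square mod `ℓ`.
[cite: Lang1987, Ch. 13 §4 Thm. 12 (PDF p. 140)] [cite: BurungaleFlach2024, proof of Cor. 2 (arXiv p. 4)] -/
theorem frobeniusTrace_eq_zero_of_not_isSquare_cmFieldDiscr (W : WeierstrassCurve ℚ)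
    [W.IsElliptic] [W.IsGloballyMinimal] (hj : W.j ∈ maximalCMJInvariants) (ℓ : ℕ) [Fact ℓ.Prime]
    (hℓd : ¬ (ℓ : ℤ) ∣ 2 * cmFieldDiscr W.j) (hℓΔ : ¬ (ℓ : ℤ) ∣ minimalDiscriminantInt W)
    (hinert : ¬ IsSquare ((cmFieldDiscr W.j : ℤ) : ZMod ℓ)) : W.frobeniusTrace ℓ = 0 :=
  frobeniusTrace_eq_zero_of_legendreSym_cmFieldDiscr_eq_neg_one W hj ℓ hℓd hℓΔ
    ((legendreSym.eq_neg_one_iff ℓ).mpr hinert)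

/-- **Deuring + Dirichlet: a good prime `ℓ ≡ −1 (mod 4|d_K|)`, `ℓ > |Δ_min|`, has `a_ℓ = 0`** for a
globally minimal `W` with `j(W) ∈ maximalCMJInvariants` (§1 + §3; `ℓ ∤ 2d_K` is automatic).
[cite: Lang1987, Ch. 13 §4 Thm. 12 (PDF p. 140)] [cite: BurungaleFlach2024, proof of Cor. 2 (arXiv p. 4)] -/
theorem frobeniusTrace_eq_zero_of_mod_eq (W : WeierstrassCurve ℚ) [W.IsElliptic]
    [W.IsGloballyMinimal] (hj : W.j ∈ maximalCMJInvariants) (ℓ : ℕ) [hℓ : Fact ℓ.Prime]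
    (hℓmod : ℓ % (4 * (cmFieldDiscr W.j).natAbs) = 4 * (cmFieldDiscr W.j).natAbs - 1)
    (hℓΔ : ¬ (ℓ : ℤ) ∣ minimalDiscriminantInt W) : W.frobeniusTrace ℓ = 0 := by
  obtain ⟨hdm, hm⟩ := cmFieldDiscr_eq_neg_natAbs hj
  set m : ℕ := (cmFieldDiscr W.j).natAbs with hmdef
  have hℓ4 : ℓ % 4 = 3 := by
    have h := Nat.mod_mod_of_dvd ℓ (dvd_mul_right 4 m)
    rw [hℓmod] at h
    omega
  -- `ℓ ∤ 2 d_K`: `ℓ` is odd and `ℓ ≡ −1 (mod m)` is prime to `m`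
  have hℓd : ¬ (ℓ : ℤ) ∣ 2 * cmFieldDiscr W.j := by
    intro h
    have hℓZ : Prime (ℓ : ℤ) := Nat.prime_iff_prime_int.mp hℓ.out
    rcases hℓZ.dvd_or_dvd h with h2 | hd
    · have : ℓ ∣ 2 := by exact_mod_cast h2
      have := (Nat.prime_dvd_prime_iff_eq hℓ.out Nat.prime_two).mp this
      omega
    · have hℓm : ℓ ∣ m := Int.natCast_dvd.mp hd
      have hle : ℓ ≤ m := Nat.le_of_dvd hm hℓm
      have hlt : ℓ % (4 * m) = ℓ := Nat.mod_eq_of_lt (by omega)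
      omega
  exact frobeniusTrace_eq_zero_of_legendreSym_cmFieldDiscr_eq_neg_one W hj ℓ hℓd hℓΔ
    (by rw [hdm]; exact legendreSym_neg_natCast_eq_neg_one_of_mod_eq hm hℓmod)

/-! ## §4 The isogeny to CM by the maximal order, with the CM field recorded -/

/-- **Every CM elliptic curve over `ℚ` is `ℚ`-isogenous to one with CM by the maximal order OF THE
SAME FIELD.** For `W/ℚ` with `j(W) ∈ cmJInvariants` there is an elliptic `W'/ℚ` with `W ~ W'`,
`j(W') ∈ maximalCMJInvariants` and `cmFieldDiscr j(W') = cmFieldDiscrOfJ j(W)`: the identity for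
the nine maximal values, and the tree's explicit isogenies `54000 ~ 0` (`d_K = −3`),
`287496 ~ 1728` (`−4`), `−12288000 ~ 0` (`−3`), `16581375 ~ −3375` (`−7`) transported along `j`
(`exists_isIsogenous_j_eq_of_j_eq`) for the four orders of conductor `2, 2, 3, 2` — exactly the
proof of `exists_isIsogenous_j_mem_maximalCMJInvariants_of_j_mem_nonmaximalCMJInvariants_holds`,
keeping the target `j`. Silverman, *Advanced Topics*, II Ex. 2.12(b) and App. A §3.
[cite: SilvermanAdvancedTopics1994, Exercise 2.12(b) and App. A §3 (p. 483)] -/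
theorem exists_isIsogenous_maximal_cmFieldDiscr_eq (W : WeierstrassCurve ℚ) [W.IsElliptic]
    (hj : W.j ∈ cmJInvariants) :
    ∃ (W' : WeierstrassCurve ℚ) (_ : W'.IsElliptic), IsIsogenous W W' ∧
      W'.j ∈ maximalCMJInvariants ∧ cmFieldDiscr W'.j = cmFieldDiscrOfJ W.j := by
  by_cases hmax : W.j ∈ maximalCMJInvariants
  · exact ⟨W, ‹_›, isIsogenous_self W, hmax, cmFieldDiscr_eq_cmFieldDiscrOfJ hmax⟩
  have h4 : W.j ∈ nonmaximalCMJInvariants := mem_nonmaximalCMJInvariants_iff.2 ⟨hj, hmax⟩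
  simp only [nonmaximalCMJInvariants, Finset.mem_insert, Finset.mem_singleton] at h4
  rcases h4 with h | h | h | h
  · -- `j = 54000 ~ 0`
    obtain ⟨W', hW', hiso, hjW'⟩ := exists_isIsogenous_j_eq_of_j_eq (W := W)
      (by rw [h, j_cm12]) (by rw [j_cm12]; norm_num) (by rw [j_cm12]; norm_num) isIsogenous_cm12
    refine ⟨W', hW', hiso, by rw [hjW', j_cm12']; decide, ?_⟩
    rw [hjW', j_cm12', h]
    norm_num [cmFieldDiscr, cmFieldDiscrOfJ]
  · -- `j = 287496 ~ 1728`
    obtain ⟨W', hW', hiso, hjW'⟩ := exists_isIsogenous_j_eq_of_j_eq (W := W)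
      (by rw [h, j_cm16]) (by rw [j_cm16]; norm_num) (by rw [j_cm16]; norm_num) isIsogenous_cm16
    refine ⟨W', hW', hiso, by rw [hjW', j_cm16']; decide, ?_⟩
    rw [hjW', j_cm16', h]
    norm_num [cmFieldDiscr, cmFieldDiscrOfJ]
  · -- `j = −12288000 ~ 0`
    haveI := isElliptic_threeIsogenyCodomain (m := (6 : ℚ)) (s := -4)
    obtain ⟨W', hW', hiso, hjW'⟩ := exists_isIsogenous_j_eq_of_j_eq (W := W)
      (E := threeTorsionModel (6 : ℚ) (-4)) (E' := threeIsogenyCodomain (6 : ℚ) (-4))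
      (by rw [h, j_threeTorsionModel_cm27]) (by rw [j_threeTorsionModel_cm27]; norm_num)
      (by rw [j_threeTorsionModel_cm27]; norm_num) isIsogenous_cm27
    refine ⟨W', hW', hiso, by rw [hjW', j_threeIsogenyCodomain_cm27]; decide, ?_⟩
    rw [hjW', j_threeIsogenyCodomain_cm27, h]
    norm_num [cmFieldDiscr, cmFieldDiscrOfJ]
  · -- `j = 16581375 ~ −3375`
    obtain ⟨W', hW', hiso, hjW'⟩ := exists_isIsogenous_j_eq_of_j_eq (W := W)
      (by rw [h, j_cm28]) (by rw [j_cm28]; norm_num) (by rw [j_cm28]; norm_num) isIsogenous_cm28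
    refine ⟨W', hW', hiso, by rw [hjW', j_cm28']; decide, ?_⟩
    rw [hjW', j_cm28', h]
    norm_num [cmFieldDiscr, cmFieldDiscrOfJ]

/-- … and the target may be taken GLOBALLY MINIMAL (Silverman VIII.8.3,
`hasGlobalMinimalModel_rat_holds`; `IsIsogenous.smul_right`, `variableChange_j`).
[cite: SilvermanAdvancedTopics1994, Exercise 2.12(b) and App. A §3 (p. 483)] [cite: SilvermanAEC2009, VIII.8, Cor. 8.3] -/
theorem exists_isGloballyMinimal_isIsogenous_maximal_cmFieldDiscr_eq (W : WeierstrassCurve ℚ)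
    [W.IsElliptic] (hj : W.j ∈ cmJInvariants) :
    ∃ (W' : WeierstrassCurve ℚ) (_ : W'.IsElliptic) (_ : W'.IsGloballyMinimal), IsIsogenous W W' ∧
      W'.j ∈ maximalCMJInvariants ∧ cmFieldDiscr W'.j = cmFieldDiscrOfJ W.j := by
  obtain ⟨W', hE, hiso, hjm, hd⟩ := exists_isIsogenous_maximal_cmFieldDiscr_eq W hj
  obtain ⟨C, hC⟩ := hasGlobalMinimalModel_rat_holds W'
  exact ⟨C • W', inferInstance, hC, hiso.smul_right C, by rwa [variableChange_j],
    by rwa [variableChange_j]⟩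

/-- `cmFieldDiscrOfJ j ≠ 0` forces `j ∈ cmJInvariants` (the junk value off the thirteen CM
`j`-invariants is `0`). [cite: SilvermanATAEC1994, App. A §3 (table of CM j-invariants)] -/
theorem mem_cmJInvariants_of_cmFieldDiscrOfJ_ne_zero {j : ℚ} (h : cmFieldDiscrOfJ j ≠ 0) :
    j ∈ cmJInvariants := by
  by_contra hj
  apply h
  simp only [cmJInvariants, Finset.mem_insert, Finset.mem_singleton, not_or] at hj
  obtain ⟨h0, h1728, h3375, h8000, h32768, h54000, h287496, h884736, h12288000, h16581375,
    h884736000, h147197952000, h262537412640768000⟩ := hj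
  simp [cmFieldDiscrOfJ, h0, h1728, h3375, h8000, h32768, h54000, h287496, h884736, h12288000,
    h16581375, h884736000, h147197952000, h262537412640768000]

end Summit.BirchSwinnertonDyer.Rank1Residual.X12

end
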